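import Mathlib
import HarnessLib
import Literature.Probability.MarkovChains.MetropolisHastings

/-!
# Total variation distance to stationarity is non-increasing along a finite Markov chain

HONEST FRAMING: instance-level adjudication of specific advantage claims; no claim about
BQP vs BPP or the summit.

On a finite state space `X`, for laws `μ ν : X → ℝ` (vectors; the probability hypotheses are
stated where a result needs them) and a ROW kernel `P : X → X → ℝ` (`P x y` = probability of the
move `x → y`, the convention of `MetropolisHastings.lean`):

* `tvDist μ ν = (1/2) · Σ_x |μ x − ν x|` — the total variation distance in its half-`ℓ¹` form
  [cite: LevinPeres2017, Prop. 4.2 eq. (4.2)] (the book DEFINES `‖μ − ν‖_TV = max_A |μ(A) − ν(A)|`,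
  eq. (4.1), and proves (4.2); we take (4.2) as the definition and prove the event form as the
  inequalities `sub_sum_le_tvDist` / `tvDist_eq_sum_filter`, i.e. Remark 4.3 eq. (4.5));
  this is also eq. (5) of Incudini–Mazzola, arXiv:2607.22818v1 (CLAIMS A-64);
* `stepLaw P μ = (y ↦ Σ_x μ x · P x y)` — one step of the chain acting on laws (`μP`), and
  `lawAt P μ t = (stepLaw P)^[t] μ` (`μPᵗ`);
* `tvDist_stepLaw_le` — **`‖μP − νP‖_TV ≤ ‖μ − ν‖_TV`** for a row-stochastic `P`
  [cite: LevinPeres2017, Exercise 4.2 (p. 57; solution in App. D)];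
* `tvDist_lawAt_succ_le` — **`‖μP^{t+1} − π‖_TV ≤ ‖μPᵗ − π‖_TV`** for stationary `π`
  ("advancing the chain can only move it closer to stationarity") [cite: LevinPeres2017,
  Exercise 4.2, parenthetical remark], hence `tvDist_lawAt_antitone`: `t ↦ ‖μPᵗ − π‖_TV` is
  antitone, and `tvDist_lawAt_le_of_le`: once `‖μPᵗ − π‖_TV ≤ ε` it stays `≤ ε`;
* `mixingTimeFrom P μ π ε = sInf {t | ‖μPᵗ − π‖_TV ≤ ε}` — the first time the chain started
  from the law `μ` is `ε`-close to `π` [cite: LevinPeres2017, §4.5 eq. (4.30) (`t_mix(ε) = min{t :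
  d(t) ≤ ε}` with `d(t)` the worst case over starting points; here the start is a fixed law, which
  is the quantity `Q_cl,warm(n, β, ε) = min{t ≥ 0 : ‖P_βᵗ q₀ − π_β‖_TV ≤ ε}` of arXiv:2607.22818v1
  eq. (24))], with `tvDist_lawAt_le_of_mixingTimeFrom_le`: every `t ≥ mixingTimeFrom …` is `ε`-close
  (when some time is).

* (append) `sub_sub_le_mul_of_tvDist_lawAt_le` — if every entry INTO `y` is `≤ c` then
  `‖μPᵗ − π‖_TV ≤ ε ⇒ π y − μ y − ε ≤ t·c` (folklore; event form of TV), and its instantiation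
  `mhKernel_uniformProposal_mixing_lower_bound`: the UNIFORM-proposal Metropolis chain (arXiv:2607.22818
  eq. (9)) satisfies `|X|·(π y − μ y − ε) ≤ t`, a `2ⁿ`-type floor under the paper's eq.-(24) count.

Everything is proved (finite sums; 0 named facts).  Context (cell pub-qadeq, OPEN-21 / CLAIMS
A-64): the lane measures `min{t : ‖law_t − π_β‖_TV ≤ ε}` for several classical walks; the
antitonicity theorem is what makes "the first crossing time" the same as "the time after which the
chain is ε-close", for the exact law (a Monte-Carlo ESTIMATE of the distance need not be monotone).
Nothing here concerns spectral gaps, any specific chain, or any advantage claim.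
-/

namespace Literature.Probability.MarkovChains

open Finset

variable {X : Type*} [Fintype X]

/-! ## Total variation distance (half-`ℓ¹` form) -/

/-- `‖μ − ν‖_TV = (1/2) Σ_x |μ x − ν x|`. [cite: LevinPeres2017, Prop. 4.2 eq. (4.2)] -/
noncomputable def tvDist (μ ν : X → ℝ) : ℝ := (1 / 2) * ∑ x, |μ x - ν x|

/-- `‖μ − ν‖_TV ≥ 0`. [folklore] -/
theorem tvDist_nonneg (μ ν : X → ℝ) : 0 ≤ tvDist μ ν :=
  mul_nonneg (by norm_num) (sum_nonneg fun x _ => abs_nonneg _)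

/-- `‖μ − μ‖_TV = 0`. [folklore] -/
theorem tvDist_self (μ : X → ℝ) : tvDist μ μ = 0 := by
  simp [tvDist]

/-- Symmetry. [folklore] -/
theorem tvDist_comm (μ ν : X → ℝ) : tvDist μ ν = tvDist ν μ := by
  unfold tvDist; congr 1; exact sum_congr rfl fun x _ => abs_sub_comm _ _

/-- Triangle inequality. [cite: LevinPeres2017, Remark 4.4 eq. (4.6)] -/
theorem tvDist_triangle (μ ν η : X → ℝ) : tvDist μ η ≤ tvDist μ ν + tvDist ν η := by
  unfold tvDist
  rw [← mul_add, ← sum_add_distrib]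
  gcongr with x
  exact abs_sub_le _ _ _

/-- `‖μ − ν‖_TV = 0 ↔ μ = ν`. [folklore] -/
theorem tvDist_eq_zero_iff (μ ν : X → ℝ) : tvDist μ ν = 0 ↔ μ = ν := by
  constructor
  · intro h
    have h2 : ∑ x, |μ x - ν x| = 0 := by
      unfold tvDist at h; linarith
    rw [sum_eq_zero_iff_of_nonneg fun x _ => abs_nonneg _] at h2
    funext x
    have := h2 x (mem_univ x)
    rwa [abs_eq_zero, sub_eq_zero] at this
  · rintro rfl; exact tvDist_self μ

/-- For two laws of total mass `1` with non-negative entries, `‖μ − ν‖_TV ≤ 1`.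
[cite: LevinPeres2017, §4.4 ("the largest possible total variation distance between
distributions, which is 1")] -/
theorem tvDist_le_one {μ ν : X → ℝ} (hμ : ∀ x, 0 ≤ μ x) (hν : ∀ x, 0 ≤ ν x)
    (hμ1 : ∑ x, μ x = 1) (hν1 : ∑ x, ν x = 1) : tvDist μ ν ≤ 1 := by
  unfold tvDist
  have : ∑ x, |μ x - ν x| ≤ ∑ x, (μ x + ν x) := by
    gcongr with x
    rw [abs_le]; constructor <;> linarith [hμ x, hν x]
  rw [sum_add_distrib, hμ1, hν1] at this
  linarith

/-- Event form, one direction: for every event `A`, `μ(A) − ν(A) ≤ ‖μ − ν‖_TV` when the two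
laws have the same total mass. [cite: LevinPeres2017, eq. (4.1) with Prop. 4.2 (proof, eq. (4.3))] -/
theorem sub_sum_le_tvDist [DecidableEq X] {μ ν : X → ℝ} (hmass : ∑ x, μ x = ∑ x, ν x)
    (A : Finset X) : ∑ x ∈ A, μ x - ∑ x ∈ A, ν x ≤ tvDist μ ν := by
  unfold tvDist
  have hsplit : ∑ x, |μ x - ν x| = ∑ x ∈ A, |μ x - ν x| + ∑ x ∈ Aᶜ, |μ x - ν x| :=
    (sum_add_sum_compl A _).symm
  have hA : ∑ x ∈ A, μ x - ∑ x ∈ A, ν x ≤ ∑ x ∈ A, |μ x - ν x| := by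
    rw [← sum_sub_distrib]; exact sum_le_sum fun x _ => le_abs_self _
  -- the complement carries the opposite difference, by equality of total mass
  have hmassA : (∑ x ∈ A, μ x - ∑ x ∈ A, ν x) = -(∑ x ∈ Aᶜ, μ x - ∑ x ∈ Aᶜ, ν x) := by
    have h1 := sum_add_sum_compl A μ
    have h2 := sum_add_sum_compl A ν
    linarith
  have hAc : -(∑ x ∈ Aᶜ, μ x - ∑ x ∈ Aᶜ, ν x) ≤ ∑ x ∈ Aᶜ, |μ x - ν x| := by
    rw [← sum_sub_distrib, ← sum_neg_distrib]
    exact sum_le_sum fun x _ => by rw [neg_sub]; exact (le_abs_self _).trans (abs_sub_comm _ _).le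
  linarith

/-- Event form, equality: `‖μ − ν‖_TV = Σ_{x : μ x ≥ ν x} (μ x − ν x)` when the two laws have the
same total mass. [cite: LevinPeres2017, Remark 4.3 eq. (4.5)] -/
theorem tvDist_eq_sum_filter [DecidableEq X] {μ ν : X → ℝ} (hmass : ∑ x, μ x = ∑ x, ν x) :
    tvDist μ ν = ∑ x ∈ univ.filter (fun x => ν x ≤ μ x), (μ x - ν x) := by
  unfold tvDist
  set B := univ.filter (fun x => ν x ≤ μ x) with hB
  have hsplit : ∑ x, |μ x - ν x| = ∑ x ∈ B, |μ x - ν x| + ∑ x ∈ Bᶜ, |μ x - ν x| :=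
    (sum_add_sum_compl B _).symm
  have hBabs : ∑ x ∈ B, |μ x - ν x| = ∑ x ∈ B, (μ x - ν x) :=
    sum_congr rfl fun x hx => abs_of_nonneg (by rw [hB, mem_filter] at hx; linarith [hx.2])
  have hBcabs : ∑ x ∈ Bᶜ, |μ x - ν x| = -∑ x ∈ Bᶜ, (μ x - ν x) := by
    rw [← sum_neg_distrib]
    exact sum_congr rfl fun x hx => by
      rw [hB, mem_compl, mem_filter] at hx
      have hlt : μ x < ν x := not_le.mp fun h => hx ⟨mem_univ x, h⟩
      rw [abs_of_neg (by linarith)]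
  have hbal : ∑ x ∈ B, (μ x - ν x) = -∑ x ∈ Bᶜ, (μ x - ν x) := by
    have h1 := sum_add_sum_compl B μ
    have h2 := sum_add_sum_compl B ν
    rw [sum_sub_distrib, sum_sub_distrib]; linarith
  rw [hsplit, hBabs, hBcabs, ← hbal]; ring

/-! ## One step of the chain on laws, and its iterates -/

/-- `μP`: the law after one step, `(μP)(y) = Σ_x μ x · P x y` (row kernel).
[cite: LevinPeres2017, §1.1 (the law `μ_t = μ_{t-1} P` as a row vector)] -/
def stepLaw (P : X → X → ℝ) (μ : X → ℝ) : X → ℝ := fun y => ∑ x, μ x * P x y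

/-- `μPᵗ`: the law after `t` steps. [cite: LevinPeres2017, §1.1 (`μ_t = μ_0 Pᵗ`)] -/
def lawAt (P : X → X → ℝ) (μ : X → ℝ) (t : ℕ) : X → ℝ := (stepLaw P)^[t] μ

/-- `μP⁰ = μ`. [folklore] -/
theorem lawAt_zero (P : X → X → ℝ) (μ : X → ℝ) : lawAt P μ 0 = μ := rfl

/-- `μP^{t+1} = (μPᵗ)P`. [folklore] -/
theorem lawAt_succ (P : X → X → ℝ) (μ : X → ℝ) (t : ℕ) :
    lawAt P μ (t + 1) = stepLaw P (lawAt P μ t) := by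
  unfold lawAt; rw [Function.iterate_succ_apply']

/-- A stationary law is fixed by the step: `πP = π`. [cite: LevinPeres2017, §1.5 eq. (1.22)
(`π = πP`)] -/
theorem stepLaw_eq_self_of_isStationary {π : X → ℝ} {P : X → X → ℝ} (h : IsStationary π P) :
    stepLaw P π = π := funext h

/-- A stationary law is fixed at every time: `πPᵗ = π`. [folklore] -/
theorem lawAt_eq_self_of_isStationary {π : X → ℝ} {P : X → X → ℝ} (h : IsStationary π P)
    (t : ℕ) : lawAt P π t = π := by
  induction t with
  | zero => rfl
  | succ t ih => rw [lawAt_succ, ih, stepLaw_eq_self_of_isStationary h]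

/-- A row-stochastic kernel: non-negative entries, unit row sums.
[cite: LevinPeres2017, §1.1 ("P is stochastic, that is, its entries are all non-negative and
Σ_y P(x,y) = 1 for all x")] -/
def IsRowStochastic (P : X → X → ℝ) : Prop := (∀ x y, 0 ≤ P x y) ∧ ∀ x, ∑ y, P x y = 1

/-- The step preserves total mass for a row-stochastic kernel. [folklore] -/
theorem sum_stepLaw {P : X → X → ℝ} (hP : IsRowStochastic P) (μ : X → ℝ) :
    ∑ y, stepLaw P μ y = ∑ x, μ x := by
  unfold stepLaw
  rw [sum_comm]
  exact sum_congr rfl fun x _ => by rw [← mul_sum, hP.2 x, mul_one]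

/-- The step preserves non-negativity for a row-stochastic kernel. [folklore] -/
theorem stepLaw_nonneg {P : X → X → ℝ} (hP : IsRowStochastic P) {μ : X → ℝ} (hμ : ∀ x, 0 ≤ μ x)
    (y : X) : 0 ≤ stepLaw P μ y :=
  sum_nonneg fun x _ => mul_nonneg (hμ x) (hP.1 x y)

/-! ## Contraction and monotonicity -/

/-- **`‖μP − νP‖_TV ≤ ‖μ − ν‖_TV`** for a row-stochastic kernel and any two vectors `μ, ν`.
[cite: LevinPeres2017, Exercise 4.2 (p. 57)] -/
theorem tvDist_stepLaw_le {P : X → X → ℝ} (hP : IsRowStochastic P) (μ ν : X → ℝ) :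
    tvDist (stepLaw P μ) (stepLaw P ν) ≤ tvDist μ ν := by
  have key : ∑ y, |stepLaw P μ y - stepLaw P ν y| ≤ ∑ x, |μ x - ν x| :=
    calc ∑ y, |stepLaw P μ y - stepLaw P ν y|
        = ∑ y, |∑ x, (μ x - ν x) * P x y| := by
          refine sum_congr rfl fun y _ => ?_
          unfold stepLaw
          rw [← sum_sub_distrib]
          exact congrArg _ (sum_congr rfl fun x _ => by ring)
      _ ≤ ∑ y, ∑ x, |μ x - ν x| * P x y := by
          refine sum_le_sum fun y _ => (abs_sum_le_sum_abs _ _).trans (le_of_eq ?_)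
          exact sum_congr rfl fun x _ => by rw [abs_mul, abs_of_nonneg (hP.1 x y)]
      _ = ∑ x, |μ x - ν x| := by
          rw [sum_comm]
          exact sum_congr rfl fun x _ => by rw [← mul_sum, hP.2 x, mul_one]
  unfold tvDist
  linarith

/-- **`‖μP^{t+1} − π‖_TV ≤ ‖μPᵗ − π‖_TV`** for a row-stochastic kernel with stationary law `π`:
"advancing the chain can only move it closer to stationarity".
[cite: LevinPeres2017, Exercise 4.2 (parenthetical remark)] -/
theorem tvDist_lawAt_succ_le {P : X → X → ℝ} (hP : IsRowStochastic P) {π : X → ℝ}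
    (hπ : IsStationary π P) (μ : X → ℝ) (t : ℕ) :
    tvDist (lawAt P μ (t + 1)) π ≤ tvDist (lawAt P μ t) π := by
  conv_lhs => rw [lawAt_succ, ← stepLaw_eq_self_of_isStationary hπ]
  exact tvDist_stepLaw_le hP _ _

/-- The distance to stationarity `t ↦ ‖μPᵗ − π‖_TV` is antitone.
[cite: LevinPeres2017, Exercise 4.2 ("Deduce that for any t ≥ 0, d(t+1) ≤ d(t)")] -/
theorem tvDist_lawAt_antitone {P : X → X → ℝ} (hP : IsRowStochastic P) {π : X → ℝ}
    (hπ : IsStationary π P) (μ : X → ℝ) : Antitone fun t => tvDist (lawAt P μ t) π :=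
  antitone_nat_of_succ_le fun t => tvDist_lawAt_succ_le hP hπ μ t

/-- Once `ε`-close, always `ε`-close: `‖μPˢ − π‖_TV ≤ ε` and `s ≤ t` give `‖μPᵗ − π‖_TV ≤ ε`.
[cite: LevinPeres2017, Exercise 4.2] -/
theorem tvDist_lawAt_le_of_le {P : X → X → ℝ} (hP : IsRowStochastic P) {π : X → ℝ}
    (hπ : IsStationary π P) (μ : X → ℝ) {ε : ℝ} {s t : ℕ} (hst : s ≤ t)
    (hs : tvDist (lawAt P μ s) π ≤ ε) : tvDist (lawAt P μ t) π ≤ ε :=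
  (tvDist_lawAt_antitone hP hπ μ hst).trans hs

/-! ## The first time the chain from a given law is `ε`-close to `π` -/

/-- `min {t : ‖μPᵗ − π‖_TV ≤ ε}` — the mixing time of the chain started from the law `μ`
(junk value `0` when no such `t` exists, by `Nat.sInf_empty`).
[cite: LevinPeres2017, §4.5 eq. (4.30) (with a fixed initial law in place of the worst case `d(t)`)];
this is `Q_cl,warm(n, β, ε)` of Incudini–Mazzola arXiv:2607.22818v1 eq. (24) for `μ = π_{β₀}`. -/
noncomputable def mixingTimeFrom (P : X → X → ℝ) (μ π : X → ℝ) (ε : ℝ) : ℕ :=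
  sInf {t | tvDist (lawAt P μ t) π ≤ ε}

/-- If the chain is `ε`-close at some time, it is `ε`-close at `mixingTimeFrom`. [folklore] -/
theorem tvDist_lawAt_mixingTimeFrom_le (P : X → X → ℝ) (μ π : X → ℝ) {ε : ℝ} {t₀ : ℕ}
    (h : tvDist (lawAt P μ t₀) π ≤ ε) : tvDist (lawAt P μ (mixingTimeFrom P μ π ε)) π ≤ ε :=
  Nat.sInf_mem (s := {t | tvDist (lawAt P μ t) π ≤ ε}) ⟨t₀, h⟩

/-- `mixingTimeFrom` is a lower bound for every `ε`-close time. [folklore] -/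
theorem mixingTimeFrom_le (P : X → X → ℝ) (μ π : X → ℝ) {ε : ℝ} {t₀ : ℕ}
    (h : tvDist (lawAt P μ t₀) π ≤ ε) : mixingTimeFrom P μ π ε ≤ t₀ :=
  Nat.sInf_le h

/-- For a row-stochastic kernel with stationary `π`: every time `t ≥ mixingTimeFrom P μ π ε` is
`ε`-close, provided some time is. [cite: LevinPeres2017, Exercise 4.2 with §4.5 eq. (4.30)] -/
theorem tvDist_lawAt_le_of_mixingTimeFrom_le {P : X → X → ℝ} (hP : IsRowStochastic P)
    {π : X → ℝ} (hπ : IsStationary π P) (μ : X → ℝ) {ε : ℝ} {t₀ t : ℕ}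
    (h : tvDist (lawAt P μ t₀) π ≤ ε) (ht : mixingTimeFrom P μ π ε ≤ t) :
    tvDist (lawAt P μ t) π ≤ ε :=
  tvDist_lawAt_le_of_le hP hπ μ ht (tvDist_lawAt_mixingTimeFrom_le P μ π h)

/-- The Metropolis–Hastings kernel of `MetropolisHastings.lean` is row-stochastic when the proposal
matrix is non-negative with row sums `≤ 1` and `π > 0`, so all of the above applies to it with its
stationary law `π` (`mhKernel_isStationary`). [folklore] -/
theorem mhKernel_isRowStochastic [DecidableEq X] {T : X → X → ℝ} {π : X → ℝ}
    (hT : ∀ x y, 0 ≤ T x y) (hTrow : ∀ x, ∑ y, T x y ≤ 1) (hπ : ∀ x, 0 < π x) :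
    IsRowStochastic (mhKernel T π) :=
  ⟨mhKernel_nonneg hT hTrow hπ, mhKernel_sum_eq_one T π⟩


/-! ## A lower bound on the `ε`-mixing time from the kernel's entries into one state

(Append, harvest-1 gen 6.)  If every transition INTO a state `y` has probability at most `c`, the
mass at `y` can grow by at most `c` per step, so a chain started from a law `μ` cannot be `ε`-close
in total variation to a law `π` before time `(π y − μ y − ε)/c`.  This is the event form of total
variation (`‖ν − π‖_TV ≥ π(A) − ν(A)`, [cite: LevinPeres2017, eq. (4.1) / Prop. 4.2], used with
`A = {y}` exactly as in the counting bound of [cite: LevinPeres2017, §7.1.1]) plus bookkeeping;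
`[folklore]`.  For the Metropolis chain with the UNIFORM proposal `T x y = 1/|X|` of
Incudini–Mazzola arXiv:2607.22818v1 eq. (9) (`mhKernel` with constant `T`; off-diagonal entries
`≤ 1/|X|` by `mhRate_le`) it says that the paper's eq.-(24) query count obeys
`Q_cl,warm ≥ |X| · (π_β(y) − π_β₀(y) − ε) = 2ⁿ · (π_β(y) − π_β₀(y) − ε)` for every configuration `y`
— in particular for the ground state, whose Gibbs weight at `β = 4` is close to `1` on the cell's
instances while the warm start gives it much less (CLAIMS A-64 / OPEN-21, DEQ-A64): the fitted
exponent `ν = 0.976` of the paper's Fig. 8 is this `2ⁿ`.  Nothing here is specific to that paper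
beyond the instantiation `mhKernel_uniformProposal_mixing_lower_bound`.
-/

/-- The step preserves non-negativity (pointwise form for iterates). [folklore] -/
theorem lawAt_nonneg {P : X → X → ℝ} (hP : IsRowStochastic P) {μ : X → ℝ} (hμ : ∀ x, 0 ≤ μ x)
    (t : ℕ) (y : X) : 0 ≤ lawAt P μ t y := by
  induction t generalizing y with
  | zero => exact hμ y
  | succ t ih => rw [lawAt_succ]; exact stepLaw_nonneg hP ih y

/-- The iterates preserve total mass. [folklore] -/
theorem sum_lawAt {P : X → X → ℝ} (hP : IsRowStochastic P) (μ : X → ℝ) (t : ℕ) :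
    ∑ y, lawAt P μ t y = ∑ x, μ x := by
  induction t with
  | zero => rfl
  | succ t ih => rw [lawAt_succ, sum_stepLaw hP, ih]

/-- One step raises the mass at `y` by at most `c` when every off-diagonal entry into `y` is `≤ c`
and the law is a probability vector. [folklore] -/
theorem stepLaw_apply_le [DecidableEq X] {P : X → X → ℝ} (hP : IsRowStochastic P) {μ : X → ℝ}
    (hμ : ∀ x, 0 ≤ μ x) (hμ1 : ∑ x, μ x = 1) {y : X} {c : ℝ} (hc0 : 0 ≤ c)
    (hc : ∀ x, x ≠ y → P x y ≤ c) : stepLaw P μ y ≤ μ y + c := by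
  unfold stepLaw
  rw [← add_sum_erase _ _ (mem_univ y)]
  have hPyy : P y y ≤ 1 :=
    calc P y y = ∑ z ∈ {y}, P y z := by rw [sum_singleton]
      _ ≤ ∑ z, P y z := sum_le_sum_of_subset_of_nonneg (by simp) fun z _ _ => hP.1 y z
      _ = 1 := hP.2 y
  have h1 : μ y * P y y ≤ μ y := by
    calc μ y * P y y ≤ μ y * 1 := mul_le_mul_of_nonneg_left hPyy (hμ y)
      _ = μ y := mul_one _
  have h2 : ∑ x ∈ univ.erase y, μ x * P x y ≤ c :=
    calc ∑ x ∈ univ.erase y, μ x * P x y ≤ ∑ x ∈ univ.erase y, μ x * c :=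
          sum_le_sum fun x hx => mul_le_mul_of_nonneg_left (hc x (ne_of_mem_erase hx)) (hμ x)
      _ = (∑ x ∈ univ.erase y, μ x) * c := by rw [sum_mul]
      _ ≤ (∑ x, μ x) * c :=
          mul_le_mul_of_nonneg_right
            (sum_le_sum_of_subset_of_nonneg (erase_subset _ _) fun x _ _ => hμ x) hc0
      _ = c := by rw [hμ1, one_mul]
  linarith

/-- After `t` steps the mass at `y` is at most `μ y + t·c`. [folklore] -/
theorem lawAt_apply_le [DecidableEq X] {P : X → X → ℝ} (hP : IsRowStochastic P) {μ : X → ℝ}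
    (hμ : ∀ x, 0 ≤ μ x) (hμ1 : ∑ x, μ x = 1) {y : X} {c : ℝ} (hc0 : 0 ≤ c)
    (hc : ∀ x, x ≠ y → P x y ≤ c) (t : ℕ) : lawAt P μ t y ≤ μ y + t * c := by
  induction t with
  | zero => simp [lawAt_zero]
  | succ t ih =>
    rw [lawAt_succ]
    have hstep := stepLaw_apply_le hP (lawAt_nonneg hP hμ t) (by rw [sum_lawAt hP, hμ1]) hc0 hc
      (μ := lawAt P μ t) (y := y)
    push_cast
    linarith

/-- **Mixing-time lower bound from one state.**  For a row-stochastic `P` whose off-diagonal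
entries into `y` are `≤ c`, probability vectors `μ` (start) and `π` (target): if `‖μPᵗ − π‖_TV ≤ ε`
then `π y − μ y − ε ≤ t · c` (the event form of total variation with `A = {y}`,
[cite: LevinPeres2017, Prop. 4.2 and §7.1.1]). [folklore] -/
theorem sub_sub_le_mul_of_tvDist_lawAt_le [DecidableEq X] {P : X → X → ℝ} (hP : IsRowStochastic P)
    {μ π : X → ℝ} (hμ : ∀ x, 0 ≤ μ x) (hμ1 : ∑ x, μ x = 1) (hπ1 : ∑ x, π x = 1) {y : X} {c : ℝ}
    (hc0 : 0 ≤ c) (hc : ∀ x, x ≠ y → P x y ≤ c) {t : ℕ} {ε : ℝ}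
    (h : tvDist (lawAt P μ t) π ≤ ε) : π y - μ y - ε ≤ t * c := by
  have hmass : ∑ x, π x = ∑ x, lawAt P μ t x := by rw [sum_lawAt hP, hμ1, hπ1]
  have h1 : π y - lawAt P μ t y ≤ tvDist π (lawAt P μ t) := by
    simpa using sub_sum_le_tvDist hmass {y}
  rw [tvDist_comm] at h1
  have h2 := lawAt_apply_le hP hμ hμ1 hc0 hc t (y := y)
  linarith

/-- The same bound phrased with `mixingTimeFrom`: if the chain is ever `ε`-close, then
`π y − μ y − ε ≤ c · mixingTimeFrom P μ π ε`. [folklore] -/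
theorem sub_sub_le_mul_mixingTimeFrom [DecidableEq X] {P : X → X → ℝ} (hP : IsRowStochastic P)
    {μ π : X → ℝ} (hμ : ∀ x, 0 ≤ μ x) (hμ1 : ∑ x, μ x = 1) (hπ1 : ∑ x, π x = 1) {y : X} {c : ℝ}
    (hc0 : 0 ≤ c) (hc : ∀ x, x ≠ y → P x y ≤ c) {ε : ℝ} {t₀ : ℕ}
    (h : tvDist (lawAt P μ t₀) π ≤ ε) :
    π y - μ y - ε ≤ (mixingTimeFrom P μ π ε : ℕ) * c :=
  sub_sub_le_mul_of_tvDist_lawAt_le hP hμ hμ1 hπ1 hc0 hc (tvDist_lawAt_mixingTimeFrom_le P μ π h)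

/-- Off-diagonal entries of a Metropolis–Hastings kernel are bounded by the proposal matrix.
[folklore] -/
theorem mhKernel_le_of_ne [DecidableEq X] (T : X → X → ℝ) (π : X → ℝ) {x y : X} (h : x ≠ y) :
    mhKernel T π x y ≤ T x y := by
  rw [mhKernel_of_ne (Ne.symm h)]
  exact mhRate_le T π x y

/-- **The uniform-proposal Metropolis chain cannot be `ε`-close before time
`|X| · (π y − μ y − ε)`.**  For the constant proposal `T x y = 1/|X|` (Incudini–Mazzola
arXiv:2607.22818v1 eq. (9): "Uniform moves propose a configuration uniformly at random") and any
positive target weight `π` normalised to a probability vector, started from any probability vector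
`μ`: `‖μPᵗ − π‖_TV ≤ ε` forces `|X| · (π y − μ y − ε) ≤ t` for every state `y`.  With `|X| = 2ⁿ`,
`π = π_β`, `μ = π_β₀` and `y` the ground state this is a `2ⁿ`-type lower bound on the paper's
eq.-(24) query count `Q_cl,warm(n, β, ε)` whenever `π_β(y) − π_β₀(y) > ε`. [folklore] -/
theorem mhKernel_uniformProposal_mixing_lower_bound [DecidableEq X] [Nonempty X] {π μ : X → ℝ}
    (hπ : ∀ x, 0 < π x) (hπ1 : ∑ x, π x = 1) (hμ : ∀ x, 0 ≤ μ x) (hμ1 : ∑ x, μ x = 1)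
    (y : X) {t : ℕ} {ε : ℝ}
    (h : tvDist (lawAt (mhKernel (fun _ _ => (1 : ℝ) / Fintype.card X) π) μ t) π ≤ ε) :
    (Fintype.card X : ℝ) * (π y - μ y - ε) ≤ t := by
  set T : X → X → ℝ := fun _ _ => (1 : ℝ) / Fintype.card X with hT
  have hN : (0 : ℝ) < Fintype.card X := by exact_mod_cast Fintype.card_pos
  have hTnn : ∀ x z, 0 ≤ T x z := fun _ _ => by rw [hT]; positivity
  have hTrow : ∀ x, ∑ z, T x z ≤ 1 := fun x => by
    rw [hT, sum_const, card_univ, nsmul_eq_mul]; field_simp; rfl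
  have hP : IsRowStochastic (mhKernel T π) := mhKernel_isRowStochastic hTnn hTrow hπ
  have hc : ∀ x, x ≠ y → mhKernel T π x y ≤ 1 / Fintype.card X := fun x hx => mhKernel_le_of_ne T π hx
  have key := sub_sub_le_mul_of_tvDist_lawAt_le hP hμ hμ1 hπ1 (by positivity) hc h (y := y)
  -- key : π y - μ y - ε ≤ t * (1 / card)
  calc (Fintype.card X : ℝ) * (π y - μ y - ε) ≤ (Fintype.card X : ℝ) * (t * (1 / Fintype.card X)) :=
        mul_le_mul_of_nonneg_left key hN.le
    _ = t := by field_simp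

end Literature.Probability.MarkovChains
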